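import Summits.Ventures.HodgeRepro2.T5DualPairSwap
import Summits.Ventures.HodgeRepro2.T5TensorSeparation
import Summits.Ventures.HodgeRepro2.T5TensorSlot

/-!
# T5LocalComponent — «global ≠ 0 ⟹ local ≠ 0»: a non-zero intertwiner of external tensor
products has a non-zero component on each factor

Kernel witness (cell pub-hodge-repro2, seat p3, Tier-5 support for sub-step N2) for the [P] step
of route/T4N-route-3.md §2(i) = route/T5-N2-route-3.md row N2.2.1 («global ≠ 0 ⟹ local ≠ 0 at
every finite v … proof given in full»):

«… a non-zero element of Hom_{U(V)(𝔸)}(ω_ψ ⊗ σ̄, 𝟙) …, and since ω_ψ = ⊗′ω_{ψ,v} and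
σ̄ = ⊗′σ̄_v are restricted tensor products …, its v-component is a non-zero element of
Hom_{U(V_v)}(ω_{ψ,v} ⊗ σ̄_v, 𝟙) = Hom_{U(V_v)}(ω_{ψ,v}, σ_v) for every finite v».

What is kernel-checked here (the cell's own `extTprod` (T5SplittingTwist), `HasPartner`
(T5DualPairSwap), p4's tensor-slot lemma `exists_tmul_ne_zero` (T5TensorSlot, p389948 — the
«non-zero on a pure tensor» step of the same §2(i) argument) and p8's coordinate maps `coordMap`
(T5TensorSeparation, p391188); nothing re-declared): for a product `G₁ × G₂` acting on a tensor
product `X₁ ⊗ X₂` through `ρ₁ ⊠ ρ₂` (the place `v` against the rest),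

* `exists_invariant_left`: a non-zero `G₁ × G₂`-invariant linear functional on `X₁ ⊗ X₂` has a
  non-zero `G₁`-invariant slice `x₁ ↦ ℓ (x₁ ⊗ x₂)` — «Hom(ω ⊗ σ̄, 𝟙) ≠ 0 ⟹ Hom(ω_v ⊗ σ̄_v, 𝟙) ≠ 0»;
* `coordMap_map`, `exists_intertwiningMap_left`: a non-zero `G₁ × G₂`-intertwiner
  `A₁ ⊠ A₂ → B₁ ⊠ B₂` yields a non-zero `G₁`-intertwiner `A₁ → B₁` (slice at a vector `a₂`, then
  a coordinate functional on `B₂`) — «Hom(ω, σ ⊠ π) ≠ 0 ⟹ Hom(ω_v, σ_v ⊠ π_v) ≠ 0»;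
* `hasPartner_of_extTprod`: the same in the cell's partner language — if the partner relation
  holds for `ω_v ⊠ ω^v` against `(σ_v ⊠ π_v) ⊠ (rest)`, it holds for `ω_v` against `(σ_v, π_v)`.

What stays prose (labels unchanged): that the adelic representations ARE restricted tensor
products with the regrouping `G(𝔸) = G_v × G^v` (bookkeeping), and the theta-integral step that
produces the non-zero global functional.

README §8(d): this file uses an L-value-free non-vanishing device: NO.
-/

namespace Summit.Ventures.HodgeRepro2.T5LocalComponent

open Summit.Ventures.HodgeRepro2.T5SplittingTwist (extTprod extTprod_apply)
open Summit.Ventures.HodgeRepro2.T5TensorSeparation (coordMap coordMap_tmul exists_coordMap_ne_zero)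
open Summit.Ventures.HodgeRepro2.T5TensorSlot (exists_tmul_ne_zero)
open Summit.Ventures.HodgeRepro2.T5DualPairSwap (HasPartner)
open TensorProduct Representation

variable {k G₁ G₂ : Type*} [Field k] [Monoid G₁] [Monoid G₂]

section Functional

variable {X₁ X₂ : Type*} [AddCommGroup X₁] [Module k X₁] [AddCommGroup X₂] [Module k X₂]

/-- A non-zero `G₁ × G₂`-invariant functional on `X₁ ⊗ X₂` restricts to a non-zero
`G₁`-invariant functional on `X₁` (the slice at a suitable `x₂`). -/
theorem exists_invariant_left (ρ₁ : Representation k G₁ X₁) (ρ₂ : Representation k G₂ X₂)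
    {ℓ : X₁ ⊗[k] X₂ →ₗ[k] k} (hℓ0 : ℓ ≠ 0)
    (hℓ : (extTprod ρ₁ ρ₂).IsIntertwiningMap (Representation.trivial k (G₁ × G₂) k) ℓ) :
    ∃ ℓ₁ : X₁ →ₗ[k] k, ℓ₁ ≠ 0 ∧ ρ₁.IsIntertwiningMap (Representation.trivial k G₁ k) ℓ₁ := by
  obtain ⟨x₁, x₂, hx⟩ := exists_tmul_ne_zero ℓ hℓ0
  refine ⟨ℓ ∘ₗ (TensorProduct.mk k X₁ X₂).flip x₂, ?_, ⟨fun g x => ?_⟩⟩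
  · intro h
    apply hx
    have := LinearMap.congr_fun h x₁
    simpa using this
  · have := hℓ.isIntertwining (g, 1) (x ⊗ₜ[k] x₂)
    simp only [extTprod_apply, map_tmul, map_one, Module.End.one_apply,
      Representation.trivial_apply] at this
    simpa using this

end Functional

section Hom

variable {A₁ A₂ B₁ B₂ : Type*} [AddCommGroup A₁] [Module k A₁] [AddCommGroup A₂] [Module k A₂]
  [AddCommGroup B₁] [Module k B₁] [AddCommGroup B₂] [Module k B₂]

/-- p8's coordinate maps commute with any operator on the first factor. -/
theorem coordMap_map {κ : Type*} [DecidableEq κ] (c : Module.Basis κ k B₂) (j : κ)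
    (f : B₁ →ₗ[k] B₁) (x : B₁ ⊗[k] B₂) :
    coordMap (S := k) c j (TensorProduct.map f LinearMap.id x) = f (coordMap (S := k) c j x) := by
  induction x using TensorProduct.induction_on with
  | zero => simp
  | tmul m n => simp [coordMap_tmul]
  | add x y hx hy => simp [map_add, hx, hy]

/-- A non-zero `G₁ × G₂`-intertwiner `A₁ ⊠ A₂ → B₁ ⊠ B₂` yields a non-zero `G₁`-intertwiner
`A₁ → B₁`: slice at a vector `a₂` with `Φ (a₁ ⊗ a₂) ≠ 0`, then apply a coordinate functional of
`B₂` that does not kill `Φ (a₁ ⊗ a₂)`. -/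
theorem exists_intertwiningMap_left (σ₁ : Representation k G₁ A₁) (σ₂ : Representation k G₂ A₂)
    (τ₁ : Representation k G₁ B₁) (τ₂ : Representation k G₂ B₂)
    {Φ : A₁ ⊗[k] A₂ →ₗ[k] B₁ ⊗[k] B₂} (hΦ0 : Φ ≠ 0)
    (hΦ : (extTprod σ₁ σ₂).IsIntertwiningMap (extTprod τ₁ τ₂) Φ) :
    ∃ f : A₁ →ₗ[k] B₁, f ≠ 0 ∧ σ₁.IsIntertwiningMap τ₁ f := by
  classical
  obtain ⟨a₁, a₂, ha⟩ := exists_tmul_ne_zero Φ hΦ0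
  let c := Module.Basis.ofVectorSpace k B₂
  obtain ⟨j, hj⟩ := exists_coordMap_ne_zero (S := k) c ha
  refine ⟨coordMap (S := k) c j ∘ₗ Φ ∘ₗ (TensorProduct.mk k A₁ A₂).flip a₂, ?_, ⟨fun g a => ?_⟩⟩
  · intro h
    apply hj
    have := LinearMap.congr_fun h a₁
    simpa using this
  · have := hΦ.isIntertwining (g, 1) (a ⊗ₜ[k] a₂)
    simp only [extTprod_apply, map_tmul, map_one, Module.End.one_apply] at this
    simp only [LinearMap.comp_apply, LinearMap.flip_apply, TensorProduct.mk_apply]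
    rw [this, Module.End.one_eq_id]
    exact coordMap_map c j (τ₁ g) _

/-- The partner relation descends to the factor: if `ω_v ⊠ ω^v` has a non-zero intertwiner to
`(σ_v ⊠ π_v) ⊠ B₂`, then `(σ_v, π_v)` are partners of `ω_v`. -/
theorem hasPartner_of_extTprod {G H : Type*} [Monoid G] [Monoid H] {V V₁ V₂ : Type*}
    [AddCommGroup V] [Module k V] [AddCommGroup V₁] [Module k V₁] [AddCommGroup V₂] [Module k V₂]
    (ω : Representation k (G × H) V) (ω' : Representation k G₂ A₂) (σ : Representation k G V₁)
    (π : Representation k H V₂) (τ₂ : Representation k G₂ B₂)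
    {Φ : V ⊗[k] A₂ →ₗ[k] (V₁ ⊗[k] V₂) ⊗[k] B₂} (hΦ0 : Φ ≠ 0)
    (hΦ : (extTprod ω ω').IsIntertwiningMap (extTprod (extTprod σ π) τ₂) Φ) :
    HasPartner ω σ π :=
  exists_intertwiningMap_left ω ω' (extTprod σ π) τ₂ hΦ0 hΦ

end Hom

end Summit.Ventures.HodgeRepro2.T5LocalComponent
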